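import Summits.QuantumAdvantage.AdviceFreeQNC0.CrossTeamRectangles
import Summits.QuantumAdvantage.AdviceFreeQNC0.LevelSetResidueBalance
import Summits.QuantumAdvantage.AdviceFreeQNC0.CubeTransfer
import HarnessLib

/-!
# Cell qa-qnc0 (rung F-Q1, route RingFrame, crux α `RingToElim`): the rectangle mechanism END TO END
# in its first case — a cross team whose SECOND member is cross-free loses a constant fraction of
# cells, whatever the first member does in its own block (Viola–Wigderson regime for the cross-degree)

`CrossTeamRectangles.lean` (prover qn-prover-3 gen 7): every transversal 3×3 rectangle on which team 0's
profile is row-constant and team 1's is column-constant has a lost cell, so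
`#{good rectangles} ≤ 9·4^L·4^{L'}·#LOST` (`card_goodRectangles_le`).  Here the good rectangles are
COUNTED in the first case of the proposed mechanism (memo PROVER3-MEMO-gen7 §2):

* team 1 (own block `v ∈ {0,1}^{L'}`) is CROSS-FREE — its profile `F₁ v u` does not depend on `u` (its
  dependence on `v` is arbitrary); then column-constancy is automatic;
* team 0 (own block `u ∈ {0,1}^L`) is ARBITRARY in `u` and has cross-degree `≤ d` in `v`, in the
  Viola–Wigderson regime `16·4^d ≤ L'`.

* `card_rowConst_triples_ge` — for ANY three rows `u⃗`, the transversal column triples `v⃗`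
  (`|v_j| ≡ j`) on which all three rows of team 0 are constant number `≥ (2^{L'}/384)³`: the six Boolean
  coordinates of `(F₀ (u i) ·)_i` have `≤ 64` atoms, the largest has `≥ 2^{L'}/64` points, and by the
  Viola–Wigderson bound (`atom_class_ge`, `two_pow_mul_vwErr_le` with `K = 5`) it meets every residue
  class of `|v|` in `≥ 2^{L'}/192 − (2/3)·2^{L'}/256 = 2^{L'}/384` points.
* **`crossWin_loss_of_crossFree_right`** — hence `#{good rectangles} ≥ (2^L/6)³·(2^{L'}/384)³`
  (`three_mul_card_cls_ge` for the rows) and **`2^{L+L'} ≤ 9·216·384³ · #LOST`**: the team loses at least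
  a `9.1·10⁻¹²` fraction of the cells, for every charge, every `L ≥ 2`, every `L' ≥ 16·4^d`.
* **`ringWinU_fail_of_crossFree_right`** — walk form: a walk strategy on `L + L'` bits whose cuts
  `g ≥ L` do not read the first block, and whose cuts `g < L` read the second block through polynomials
  of degree `≤ d` (for each fixed content of the first block; ARBITRARY dependence on the first block,
  no total-degree hypothesis), fails on `≥ 2^{L+L'}/(9·216·384³)` inputs.

Compared with the cell's atom-based theorems (`GenuineProductBound`, Theorem V) this needs NO structure
in the own variables — the degree enters only through residue-equidistribution of `6` level sets; compared
with the window theorems (`BlindWindow*`, `OneSidedWindow*`, T8) the hypothesis on the sighted side is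
cross-degree `≤ log₄(L'/16)` instead of total degree `≤ c√L`, with an explicit constant.  The general
case (both members cross-dependent) is the open `GoodRectangleDensity` of the memo.  The cell's statement
(prover qn-prover-3 gen 7, 2026-08-27); not in print.  WHAT THIS IS NOT: nothing for totally sighted
strategies; nothing at polylog TOTAL degree beyond the VW regime; α untouched; separation NOT moved.
-/

noncomputable section

namespace Summit.QuantumAdvantage.AdviceFreeQNC0

open Finset
open Literature.Computability.MetaComplexity Literature.Computability.MetaComplexity.Smolensky

variable {L L' : ℕ}

/-! ### Team 0's side: many transversal column triples on which three given rows are constant -/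

/-- **Row-constant transversal column triples.**  For any three rows `u⃗` of a profile `F₀` of
cross-degree `≤ d` on `L' ≥ 16·4^d` bits, at least `(2^{L'}/384)³` column triples `v⃗` with
`|v_j| ≡ j (mod 3)` have `F₀ (u i) (v j)` independent of `j` for each `i`. -/
theorem card_rowConst_triples_ge {d : ℕ} (F₀ : (Fin L → Bool) → (Fin L' → Bool) → T4)
    (hF₀ : CrossDeg d F₀) (hL' : 16 * 4 ^ d ≤ L') (u : Fin 3 → (Fin L → Bool)) :
    ((2 : ℝ) ^ L' / 384) ^ 3 ≤
      ((univ.filter fun v : Fin 3 → (Fin L' → Bool) =>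
        (∀ j, wt (v j) % 3 = j.val) ∧ (∀ i j, F₀ (u i) (v j) = F₀ (u i) (v 0))).card : ℝ) := by
  classical
  -- the six Boolean coordinates of the three rows
  set φ : Fin 6 → (Fin L' → Bool) → Bool := fun k v =>
    if k.val % 2 = 0 then (F₀ (u ⟨k.val / 2, by omega⟩) v).1
    else (F₀ (u ⟨k.val / 2, by omega⟩) v).2 with hφdef
  have hφ : ∀ k, HasDeg (φ k) d := by
    intro k
    by_cases hk : k.val % 2 = 0
    · have e : φ k = fun v => (F₀ (u ⟨k.val / 2, by omega⟩) v).1 := by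
        funext v; simp only [hφdef, hk, if_true]
      rw [e]; exact (hF₀ _).1
    · have e : φ k = fun v => (F₀ (u ⟨k.val / 2, by omega⟩) v).2 := by
        funext v; simp only [hφdef, hk, if_false]
      rw [e]; exact (hF₀ _).2
  -- same atom ⇒ same values of the three rows
  have hsame : ∀ v v' : Fin L' → Bool, (fun k => φ k v) = (fun k => φ k v') →
      ∀ i : Fin 3, F₀ (u i) v = F₀ (u i) v' := by
    intro v v' h i
    have h1 := congrFun h ⟨2 * i.val, by omega⟩
    have h2 := congrFun h ⟨2 * i.val + 1, by omega⟩
    have e1 : (⟨(2 * i.val) / 2, by omega⟩ : Fin 3) = i := Fin.ext (by simp)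
    have e2 : (⟨(2 * i.val + 1) / 2, by omega⟩ : Fin 3) = i := Fin.ext (by simp; omega)
    have hm1 : (2 * i.val) % 2 = 0 := by omega
    have hm2 : ¬ (2 * i.val + 1) % 2 = 0 := by omega
    simp only [hφdef, hm1, hm2, if_true, if_false, e1, e2] at h1 h2
    exact Prod.ext h1 h2
  -- the atoms and the largest one
  set A : (Fin 6 → Bool) → Finset (Fin L' → Bool) := fun α =>
    univ.filter fun v => (fun k => φ k v) = α with hA
  have hsum : ∑ α : Fin 6 → Bool, ((A α).card : ℝ) = (2 : ℝ) ^ L' := by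
    have h := Finset.card_eq_sum_card_fiberwise (s := (univ : Finset (Fin L' → Bool)))
      (t := (univ : Finset (Fin 6 → Bool))) (f := fun v k => φ k v) (fun _ _ => mem_univ _)
    rw [card_univ, Fintype.card_fun, Fintype.card_bool, Fintype.card_fin] at h
    have h' : ((2 ^ L' : ℕ) : ℝ) = ∑ α : Fin 6 → Bool, ((A α).card : ℝ) := by
      rw [h]; push_cast; rfl
    rw [← h']; push_cast; rfl
  obtain ⟨α, -, hα⟩ : ∃ α ∈ (univ : Finset (Fin 6 → Bool)), (2 : ℝ) ^ L' / 64 ≤ ((A α).card : ℝ) := by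
    refine Finset.exists_le_of_sum_le univ_nonempty ?_
    rw [hsum, sum_const, card_univ, Fintype.card_fun, Fintype.card_bool, Fintype.card_fin]
    norm_num
    exact le_of_eq (by ring)
  -- every residue class meets the largest atom in `≥ 2^{L'}/384` points
  have hvw : vwErr L' d ≤ 1 / 256 := by
    have h := two_pow_mul_vwErr_le (K := 5) (d := d) (L := L') (by omega)
    have : (2 : ℝ) ^ 5 = 32 := by norm_num
    rw [this] at h
    linarith
  have hcls : ∀ j : Fin 3, (2 : ℝ) ^ L' / 384 ≤
      (((A α).filter fun v => wt v % 3 = j.val % 3).card : ℝ) := by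
    intro j
    have h := atom_class_ge φ hφ α j.val
    have h2 : (0 : ℝ) ≤ (2 : ℝ) ^ L' := by positivity
    have h3 : 2 / 3 * ((2 : ℝ) ^ L' * vwErr L' d) ≤ (2 : ℝ) ^ L' / 384 := by
      have := mul_le_mul_of_nonneg_left hvw h2
      linarith
    have h4 : (2 : ℝ) ^ L' / 192 ≤ ((A α).card : ℝ) / 3 := by linarith
    exact le_trans (by linarith) h
  -- the box of such triples
  set T : Finset (Fin 3 → (Fin L' → Bool)) :=
    Fintype.piFinset fun j : Fin 3 => (A α).filter fun v => wt v % 3 = j.val % 3 with hT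
  have hTsub : T ⊆ univ.filter fun v : Fin 3 → (Fin L' → Bool) =>
      (∀ j, wt (v j) % 3 = j.val) ∧ (∀ i j, F₀ (u i) (v j) = F₀ (u i) (v 0)) := by
    intro v hv
    rw [hT, Fintype.mem_piFinset] at hv
    have hv' : ∀ j, v j ∈ A α ∧ wt (v j) % 3 = j.val % 3 := fun j => by
      have := hv j; rwa [mem_filter] at this
    rw [mem_filter]
    refine ⟨mem_univ _, fun j => ?_, fun i j => ?_⟩
    · rw [(hv' j).2]; exact Nat.mod_eq_of_lt j.isLt
    · have hj := (hv' j).1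
      have h0 := (hv' 0).1
      rw [hA, mem_filter] at hj h0
      exact hsame (v j) (v 0) (hj.2.trans h0.2.symm) i
  have hTcard : ((2 : ℝ) ^ L' / 384) ^ 3 ≤ (T.card : ℝ) := by
    rw [hT, Fintype.card_piFinset]
    push_cast
    calc ((2 : ℝ) ^ L' / 384) ^ 3 = ∏ _j : Fin 3, (2 : ℝ) ^ L' / 384 := by
          rw [prod_const, card_univ, Fintype.card_fin]
      _ ≤ ∏ j : Fin 3, (((A α).filter fun v => wt v % 3 = j.val % 3).card : ℝ) :=
          prod_le_prod (fun _ _ => by positivity) (fun j _ => hcls j)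
  exact hTcard.trans (by exact_mod_cast card_le_card hTsub)

/-! ### The loss bound -/

/-- **A cross team whose second member is cross-free loses a constant fraction of the cells.**
Team 0: arbitrary in its own block `u ∈ {0,1}^L` (`L ≥ 2`), cross-degree `≤ d` in `v`; team 1: its
profile does not depend on `u`; `L' ≥ 16·4^d`.  Then `2^{L+L'} ≤ 9·216·384³ · #{lost cells}` for every
charge `c`. -/
theorem crossWin_loss_of_crossFree_right {d : ℕ} (c : ℕ)
    (F₀ : (Fin L → Bool) → (Fin L' → Bool) → T4) (F₁ : (Fin L' → Bool) → (Fin L → Bool) → T4)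
    (hF₀ : CrossDeg d F₀) (hF₁ : ∀ v u u', F₁ v u = F₁ v u') (hL : 2 ≤ L) (hL' : 16 * 4 ^ d ≤ L') :
    (2 : ℝ) ^ (L + L') ≤ 9 * 216 * 384 ^ 3 *
      ((univ.filter fun p : (Fin L → Bool) × (Fin L' → Bool) => crossWin c F₀ F₁ p.1 p.2 = false).card : ℝ) := by
  classical
  -- the good rectangles of the parity obstruction
  set G := (univ : Finset ((Fin 3 → (Fin L → Bool)) × (Fin 3 → (Fin L' → Bool)))).filter fun R =>
      (∀ i, wt (R.1 i) % 3 = i.val) ∧ (∀ j, wt (R.2 j) % 3 = j.val) ∧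
        (∀ i j, F₀ (R.1 i) (R.2 j) = F₀ (R.1 i) (R.2 0)) ∧
          (∀ i j, F₁ (R.2 j) (R.1 i) = F₁ (R.2 j) (R.1 0)) with hG
  have hrect := card_goodRectangles_le c F₀ F₁
  -- transversal row triples and, for each, the row-constant column triples
  set S : Finset (Fin 3 → (Fin L → Bool)) := Fintype.piFinset fun i : Fin 3 => cls L i.val with hS
  set Tv : (Fin 3 → (Fin L → Bool)) → Finset (Fin 3 → (Fin L' → Bool)) := fun u =>
    univ.filter fun v : Fin 3 → (Fin L' → Bool) =>
      (∀ j, wt (v j) % 3 = j.val) ∧ (∀ i j, F₀ (u i) (v j) = F₀ (u i) (v 0)) with hTv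
  set W := (S.sigma Tv).map (Equiv.sigmaEquivProd (Fin 3 → (Fin L → Bool))
    (Fin 3 → (Fin L' → Bool))).toEmbedding with hW
  have hWsub : W ⊆ G := by
    intro R hR
    rw [hW, mem_map] at hR
    obtain ⟨⟨u, v⟩, huv, rfl⟩ := hR
    rw [mem_sigma] at huv
    obtain ⟨hu, hv⟩ := huv
    rw [hS, Fintype.mem_piFinset] at hu
    rw [hTv, mem_filter] at hv
    rw [hG, mem_filter]
    refine ⟨mem_univ _, fun i => ?_, hv.2.1, hv.2.2, fun i j => hF₁ _ _ _⟩
    have := hu i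
    unfold cls at this
    rw [mem_filter] at this
    simp only [Equiv.sigmaEquivProd, Equiv.toEmbedding_apply, Equiv.coe_fn_mk]
    rw [this.2]
    exact Nat.mod_eq_of_lt i.isLt
  have hWcard : (W.card : ℝ) = ∑ u ∈ S, ((Tv u).card : ℝ) := by
    rw [hW, card_map, card_sigma]
    push_cast
    rfl
  -- sizes
  have hScard : ((2 : ℝ) ^ L / 6) ^ 3 ≤ (S.card : ℝ) := by
    rw [hS, Fintype.card_piFinset]
    push_cast
    have h4 : (4 : ℝ) ≤ (2 : ℝ) ^ L := by
      have : (2 : ℝ) ^ 2 ≤ (2 : ℝ) ^ L := pow_le_pow_right₀ (by norm_num) hL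
      norm_num at this
      exact this
    have hcl : ∀ i : Fin 3, (2 : ℝ) ^ L / 6 ≤ ((cls L i.val).card : ℝ) := by
      intro i
      have := three_mul_card_cls_ge L i.val
      linarith
    calc ((2 : ℝ) ^ L / 6) ^ 3 = ∏ _i : Fin 3, (2 : ℝ) ^ L / 6 := by
          rw [prod_const, card_univ, Fintype.card_fin]
      _ ≤ ∏ i : Fin 3, ((cls L i.val).card : ℝ) :=
          prod_le_prod (fun _ _ => by positivity) (fun i _ => hcl i)
  have hTvcard : ∀ u, ((2 : ℝ) ^ L' / 384) ^ 3 ≤ ((Tv u).card : ℝ) := fun u =>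
    card_rowConst_triples_ge F₀ hF₀ hL' u
  have hGcard : ((2 : ℝ) ^ L / 6) ^ 3 * ((2 : ℝ) ^ L' / 384) ^ 3 ≤ (G.card : ℝ) := by
    have h1 : (S.card : ℝ) * ((2 : ℝ) ^ L' / 384) ^ 3 ≤ (W.card : ℝ) := by
      rw [hWcard]
      have := Finset.sum_le_sum fun u (_ : u ∈ S) => hTvcard u
      rw [sum_const, nsmul_eq_mul] at this
      exact this
    have h2 : (W.card : ℝ) ≤ (G.card : ℝ) := by exact_mod_cast card_le_card hWsub
    have h3 : (0 : ℝ) ≤ ((2 : ℝ) ^ L' / 384) ^ 3 := by positivity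
    nlinarith
  -- assemble
  have hrect' : (G.card : ℝ) ≤ 9 * ((4 : ℝ) ^ L * 4 ^ L' *
      ((univ.filter fun p : (Fin L → Bool) × (Fin L' → Bool) => crossWin c F₀ F₁ p.1 p.2 = false).card : ℝ)) := by
    exact_mod_cast hrect
  set LOST := ((univ.filter fun p : (Fin L → Bool) × (Fin L' → Bool) =>
    crossWin c F₀ F₁ p.1 p.2 = false).card : ℝ) with hLOST
  have h4L : (4 : ℝ) ^ L = 2 ^ L * 2 ^ L := by rw [← mul_pow]; norm_num
  have h4L' : (4 : ℝ) ^ L' = 2 ^ L' * 2 ^ L' := by rw [← mul_pow]; norm_num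
  have hpos : (0 : ℝ) < (2 : ℝ) ^ L * 2 ^ L * (2 ^ L' * 2 ^ L') := by positivity
  have key : (2 : ℝ) ^ L * 2 ^ L * (2 ^ L' * 2 ^ L') * (2 ^ L * 2 ^ L') ≤
      (2 : ℝ) ^ L * 2 ^ L * (2 ^ L' * 2 ^ L') * (9 * 216 * 384 ^ 3 * LOST) := by
    have := hGcard.trans hrect'
    rw [h4L, h4L'] at this
    nlinarith [this]
  rw [pow_add]
  exact le_of_mul_le_mul_left key hpos

/-! ### The walk-game form -/

/-- A masked Boolean function `f ∧ b` has the degree of `f`. -/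
private theorem halfFree_hasDeg_and {k : ℕ} {f : (Fin k → Bool) → Bool} {D : ℕ} (hf : HasDeg f D)
    (b : Bool) : HasDeg (fun x => f x && b) D := by
  cases b
  · have : (fun x => f x && false) = fun _ : Fin k → Bool => false := by funext x; simp
    rw [this]; exact hasDeg_false D
  · have : (fun x => f x && true) = f := by funext x; simp
    rw [this]; exact hf

/-- The first coordinate of a masked `ω`-power term. -/
private theorem halfFree_ite_fst (b : Bool) (m : ℕ) :
    (if b = true then tOmegaPow m (true, false) else ((false, false) : T4)).1 =
      (b && (tOmegaPow m (true, false)).1) := by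
  cases b <;> simp

/-- The second coordinate of a masked `ω`-power term. -/
private theorem halfFree_ite_snd (b : Bool) (m : ℕ) :
    (if b = true then tOmegaPow m (true, false) else ((false, false) : T4)).2 =
      (b && (tOmegaPow m (true, false)).2) := by
  cases b <;> simp

/-- Team 0's profile has cross-degree `≤ d` as soon as every first-block cut reads the second block
through a polynomial of degree `≤ d` for each fixed content of the first block (no total-degree
hypothesis). -/
theorem crossDeg_F0_of_right_deg {d : ℕ} (y : Fin (L + L' + 1) → (Fin (L + L') → Bool) → Bool)
    (hy : ∀ g : Fin (L + L' + 1), g.val < L → ∀ u : Fin L → Bool,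
      HasDeg (fun v : Fin L' → Bool => y g (Fin.append u v)) d) :
    CrossDeg d (F0 y) := by
  intro u
  constructor
  · have heq : (fun v => (F0 y u v).1) = fun v => decide (((univ.filter fun g : Fin (L + L' + 1) =>
        g.val < L).filter fun g => (y g (Fin.append u v) &&
          (tOmegaPow (g.val + wtPrefix u g.val) (true, false)).1) = true).card % 2 = 1) := by
      funext v
      unfold F0 t4sum
      simp only [halfFree_ite_fst]
    rw [heq]
    exact hasDeg_parity _ _ fun g hg => halfFree_hasDeg_and (hy g (mem_filter.1 hg).2 u) _
  · have heq : (fun v => (F0 y u v).2) = fun v => decide (((univ.filter fun g : Fin (L + L' + 1) =>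
        g.val < L).filter fun g => (y g (Fin.append u v) &&
          (tOmegaPow (g.val + wtPrefix u g.val) (true, false)).2) = true).card % 2 = 1) := by
      funext v
      unfold F0 t4sum
      simp only [halfFree_ite_snd]
    rw [heq]
    exact hasDeg_parity _ _ fun g hg => halfFree_hasDeg_and (hy g (mem_filter.1 hg).2 u) _

/-- Team 1's profile does not depend on the first block when no cut `g ≥ L` reads it. -/
theorem F1_eq_of_left_blind (y : Fin (L + L' + 1) → (Fin (L + L') → Bool) → Bool)
    (hy : ∀ g : Fin (L + L' + 1), ¬ g.val < L → ∀ (u u' : Fin L → Bool) (v : Fin L' → Bool),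
      y g (Fin.append u v) = y g (Fin.append u' v))
    (v : Fin L' → Bool) (u u' : Fin L → Bool) : F1 y v u = F1 y v u' := by
  unfold F1
  refine t4sum_congr _ fun g hg => ?_
  rw [hy g (mem_filter.1 hg).2 u u' v]

/-- **Walk-game form.**  A charge-`c` walk strategy on `L + L'` bits (`L ≥ 2`, `L' ≥ 16·4^d`) whose cuts
`g ≥ L` do not read the first block, and whose cuts `g < L` read the second block through polynomials
of degree `≤ d` for each fixed content of the first block, FAILS on at least
`2^{L+L'}/(9·216·384³)` inputs. -/
theorem ringWinU_fail_of_crossFree_right {d : ℕ} (c : ℕ)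
    (y : Fin (L + L' + 1) → (Fin (L + L') → Bool) → Bool)
    (hyA : ∀ g : Fin (L + L' + 1), g.val < L → ∀ u : Fin L → Bool,
      HasDeg (fun v : Fin L' → Bool => y g (Fin.append u v)) d)
    (hyB : ∀ g : Fin (L + L' + 1), ¬ g.val < L → ∀ (u u' : Fin L → Bool) (v : Fin L' → Bool),
      y g (Fin.append u v) = y g (Fin.append u' v))
    (hL : 2 ≤ L) (hL' : 16 * 4 ^ d ≤ L') :
    (2 : ℝ) ^ (L + L') ≤ 9 * 216 * 384 ^ 3 *
      ((univ.filter fun w : Fin (L + L') → Bool => ringWinU c y w = false).card : ℝ) := by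
  classical
  have h := crossWin_loss_of_crossFree_right c (F0 y) (F1 y) (crossDeg_F0_of_right_deg y hyA)
    (F1_eq_of_left_blind y hyB) hL hL'
  refine h.trans (mul_le_mul_of_nonneg_left ?_ (by norm_num))
  -- lost cells ↦ failing inputs, injectively via `Fin.append`
  have hinj : Function.Injective fun p : (Fin L → Bool) × (Fin L' → Bool) => Fin.append p.1 p.2 := by
    intro p q hpq
    have h1 : p.1 = q.1 := by
      funext i
      have := congrFun hpq (Fin.castAdd L' i)
      simpa [Fin.append_left] using this
    have h2 : p.2 = q.2 := by
      funext i
      have := congrFun hpq (Fin.natAdd L i)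
      simpa [Fin.append_right] using this
    exact Prod.ext h1 h2
  have hle : (univ.filter fun p : (Fin L → Bool) × (Fin L' → Bool) =>
      crossWin c (F0 y) (F1 y) p.1 p.2 = false).card ≤
        (univ.filter fun w : Fin (L + L') → Bool => ringWinU c y w = false).card := by
    rw [← card_image_of_injective _ hinj]
    refine card_le_card fun w hw => ?_
    rw [mem_image] at hw
    obtain ⟨p, hp, rfl⟩ := hw
    rw [mem_filter] at hp ⊢
    exact ⟨mem_univ _, by rw [ringWinU_append]; exact hp.2⟩
  exact_mod_cast hle

end Summit.QuantumAdvantage.AdviceFreeQNC0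

end
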